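import Summits.AnomalousDissipation.AnomalousDissipation.Theorems.BaireTransferDenseLoudDesignerForcesErgodicLine
import Summits.AnomalousDissipation.AnomalousDissipation.Theorems.DenseLoudDesignerForces.Negative.Scaling
import Literature.Analysis.FluidPDE.LongTimeAveragePeriodic

/-!
# Glue of the line `ergodic-budget-selection-closing` (crux `BaireTransfer.DenseLoudDesignerForces`,
# stmt-AnomalousDissipation-1143): budget selection and the CONDITIONAL composition

Sorry-free glue over the line vocabulary `Theorems/BaireTransferDenseLoudDesignerForcesErgodicLine.lean`
(namespace `…Theorems.DenseLoudDesignerForces.Ergodic`, which also proves `budget_selection`, `sqrt_forceEnergy_le`,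
`IsInvariantMeasure.enlarge`): the conditional chain `birkhoffPowerBudget_of`, `closingWithBudgets_of`,
`loudAt_of_hypLoud_of`, `ergodic_line_glue` (the registered sub-goal this file discharges) whose hypotheses are EXACTLY the seven registered stubs of the lead's skeleton
(`Cruxes/DenseLoudDesignerForces/Lines/ergodic-budget-selection-closing.lean`, reshape v2 of 2026-08-16:
`stub_denseHyperbolicLoudMeasures`, `stub_closingLemma` (enlarged phase), `stub_birkhoffMeans`,
`stub_trajectoryPowerBudget`, `stub_recurrence`, `stub_shadowBudgets`, `stub_classicalPeriodicWitness`) and whose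
conclusion is the crux BY NAME.  As the stubs land under `Theorems/` they discharge the hypotheses one by one.
No facts are asserted here.

References: the line card `Cruxes/DenseLoudDesignerForces/Lines/ergodic-budget-selection-closing.md`; FMRT 2001
Ch. IV–V; Barreira–Pesin 2023 Thm 11.10; Lian–Young 2012.
-/

set_option linter.dupNamespace false

noncomputable section

open scoped BigOperators Topology ENNReal InnerProductSpace
open Filter Set Function MeasureTheory

namespace Summit.AnomalousDissipation.AnomalousDissipation.Theorems.DenseLoudDesignerForces.Ergodic

open Literature.Analysis.FunctionSpaces Literature.Analysis.FunctionSpaces.Torus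
open Literature.Analysis.FluidPDE Literature.Analysis.FluidPDE.Torus
open Summit.AnomalousDissipation.AnomalousDissipation.Theses.BaireTransfer
open Summit.AnomalousDissipation.AnomalousDissipation.Theorems.DenseLoudDesignerForces.Negative


/-! ## §2 The conditional chain (hypotheses = the registered stubs, verbatim) -/

/-- **Birkhoff budgets WITH the pointwise power budget**, from Stubs 3a (`stub_birkhoffMeans`) and 3b
(`stub_trajectoryPowerBudget`): zero the Birkhoff limits on the null set where `D ≤ ‖F‖₂√En` fails. [folklore] -/
theorem birkhoffPowerBudget_of
    (h3a : (∀ {ν : ℝ} {F : (UnitAddTorus (Fin 3)) → (EuclideanSpace ℝ (Fin 3))} {K : Set Hsp} {φ : ℝ → Hsp → Hsp} {μ : Measure Hsp},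
      IsNSPhase ν F K φ → IsInvariantMeasure K φ μ →
      ∃ En D : Hsp → ℝ, Measurable En ∧ Measurable D ∧ (∀ x, 0 ≤ En x) ∧
        Integrable En μ ∧ Integrable D μ ∧ ∫ x, En x ∂μ = ensembleEnergy μ ∧
        ∫ x, D x ∂μ = ensembleDissipation ν μ ∧
        ∀ᵐ x ∂μ, Tendsto (energyAvg φ x) atTop (𝓝 (En x)) ∧ Tendsto (dissipAvg ν φ x) atTop (𝓝 (D x))))
    (h3b : (∀ {ν : ℝ} {F : (UnitAddTorus (Fin 3)) → (EuclideanSpace ℝ (Fin 3))} {K : Set Hsp} {φ : ℝ → Hsp → Hsp},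
      IsNSPhase ν F K φ → ∀ {x : Hsp}, x ∈ K → ∀ {e δ : ℝ},
      Tendsto (energyAvg φ x) atTop (𝓝 e) → Tendsto (dissipAvg ν φ x) atTop (𝓝 δ) →
      δ ≤ Real.sqrt (∫ y, ‖F y‖ ^ 2) * Real.sqrt e))
    {ν : ℝ} {F : (UnitAddTorus (Fin 3)) → (EuclideanSpace ℝ (Fin 3))} {K : Set Hsp} {φ : ℝ → Hsp → Hsp} {μ : Measure Hsp}
    (hK : IsNSPhase ν F K φ) (hμ : IsInvariantMeasure K φ μ) :
    ∃ En D : Hsp → ℝ, Measurable En ∧ Measurable D ∧ (∀ x, 0 ≤ En x) ∧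
      Integrable En μ ∧ Integrable D μ ∧ ∫ x, En x ∂μ = ensembleEnergy μ ∧
      ∫ x, D x ∂μ = ensembleDissipation ν μ ∧
      (∀ x, D x ≤ Real.sqrt (∫ y, ‖F y‖ ^ 2) * Real.sqrt (En x)) ∧
      ∀ᵐ x ∂μ, Tendsto (energyAvg φ x) atTop (𝓝 (En x)) ∧ Tendsto (dissipAvg ν φ x) atTop (𝓝 (D x)) := by
  obtain ⟨En, D, hEm, hDm, hE0, hEi, hDi, hIE, hID, hlim⟩ := h3a hK hμ
  set G : Set Hsp := {x | D x ≤ Real.sqrt (∫ y, ‖F y‖ ^ 2) * Real.sqrt (En x)} with hGdef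
  have hGm : MeasurableSet G :=
    measurableSet_le hDm (measurable_const.mul (Real.continuous_sqrt.measurable.comp hEm))
  have hKae : ∀ᵐ x ∂μ, x ∈ K := hμ.ae_mem
  have hGae : ∀ᵐ x ∂μ, x ∈ G := by
    filter_upwards [hKae, hlim] with x hxK hx
    exact h3b hK hxK hx.1 hx.2
  have hEae : G.indicator En =ᵐ[μ] En := hGae.mono fun x hx => Set.indicator_of_mem hx _
  have hDae : G.indicator D =ᵐ[μ] D := hGae.mono fun x hx => Set.indicator_of_mem hx _
  refine ⟨G.indicator En, G.indicator D, hEm.indicator hGm, hDm.indicator hGm, ?_, hEi.indicator hGm,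
    hDi.indicator hGm, ?_, ?_, ?_, ?_⟩
  · intro x
    by_cases hx : x ∈ G
    · rw [Set.indicator_of_mem hx]; exact hE0 x
    · rw [Set.indicator_of_notMem hx]
  · rw [← hIE]; exact integral_congr_ae hEae
  · rw [← hID]; exact integral_congr_ae hDae
  · intro x
    by_cases hx : x ∈ G
    · rw [Set.indicator_of_mem hx, Set.indicator_of_mem hx]; exact hx
    · rw [Set.indicator_of_notMem hx, Set.indicator_of_notMem hx, Real.sqrt_zero, mul_zero]
  · filter_upwards [hlim, hGae] with x hx hxG
    rw [Set.indicator_of_mem hxG, Set.indicator_of_mem hxG]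
    exact hx

/-- **Closing WITH BUDGETS**, from Stubs 4a (`stub_recurrence`), 4b (`stub_shadowBudgets`) and the closing
property: a Pesin set meets the budget cell `B` in positive measure; a typical point of the intersection has
converging time means and returns arbitrarily late and close; close the return and transfer the budgets by
shadowing. [folklore] -/
theorem closingWithBudgets_of
    (h4a : (∀ {ν : ℝ} {F : (UnitAddTorus (Fin 3)) → (EuclideanSpace ℝ (Fin 3))} {K : Set Hsp} {φ : ℝ → Hsp → Hsp} {μ : Measure Hsp},
      IsNSPhase ν F K φ → IsInvariantMeasure K φ μ → ∀ {A : Set Hsp}, MeasurableSet A → ∀ {r : ℝ}, 0 < r →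
      ∀ᵐ x ∂μ, x ∈ A → ∃ᶠ n : ℕ in atTop, φ n x ∈ A ∧ dist (φ n x) x < r))
    (h4b : (∀ {ν : ℝ} {F : (UnitAddTorus (Fin 3)) → (EuclideanSpace ℝ (Fin 3))} {K : Set Hsp} {φ : ℝ → Hsp → Hsp},
      IsNSPhase ν F K φ → ∀ {δ : ℝ}, 0 < δ →
      ∃ η : ℝ, 0 < η ∧ ∀ x ∈ K, ∀ z ∈ K, ∀ n : ℕ, 0 < n → ∀ T : ℝ, |T - n| ≤ η →
        (∀ k : ℕ, k ≤ n → dist (φ k z) (φ k x) ≤ η) →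
          |energyAvg φ z T - energyAvg φ x n| ≤ δ ∧ |dissipAvg ν φ z T - dissipAvg ν φ x n| ≤ δ))
    {ν : ℝ} {F : (UnitAddTorus (Fin 3)) → (EuclideanSpace ℝ (Fin 3))} {K : Set Hsp} {φ : ℝ → Hsp → Hsp} {μ : Measure Hsp}
    {En D : Hsp → ℝ} {E₁ ε₁ : ℝ} {B : Set Hsp} (hK : IsNSPhase ν F K φ) (hμ : IsInvariantMeasure K φ μ)
    (hcl : HasKatokClosing K φ μ) (hB : MeasurableSet B) (hμB : μ B ≠ 0)
    (hbud : ∀ x ∈ B, En x ≤ E₁ ∧ ε₁ ≤ D x)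
    (hlim : ∀ᵐ x ∂μ, Tendsto (energyAvg φ x) atTop (𝓝 (En x)) ∧ Tendsto (dissipAvg ν φ x) atTop (𝓝 (D x)))
    {δ : ℝ} (hδ : 0 < δ) :
    ∃ z ∈ K, ∃ T : ℝ, 0 < T ∧ φ T z = z ∧ energyAvg φ z T ≤ E₁ + δ ∧ ε₁ - δ ≤ dissipAvg ν φ z T := by
  obtain ⟨Λ, hΛm, hΛK, hΛμ, hclose⟩ := hcl
  -- a Pesin set meeting `B` in positive measure
  obtain ⟨ℓ, hℓ⟩ : ∃ ℓ, μ (B ∩ Λ ℓ) ≠ 0 := by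
    by_contra h
    push Not at h
    have h1 : μ (B ∩ ⋃ ℓ, Λ ℓ) = 0 := by
      rw [Set.inter_iUnion]; exact measure_iUnion_null h
    have h2 : μ B ≤ μ (B ∩ ⋃ ℓ, Λ ℓ) + μ (⋃ ℓ, Λ ℓ)ᶜ := by
      refine (measure_mono fun x hx => ?_).trans (measure_union_le _ _)
      by_cases h' : x ∈ ⋃ ℓ, Λ ℓ
      exacts [Or.inl ⟨hx, h'⟩, Or.inr h']
    rw [h1, hΛμ, add_zero] at h2
    exact hμB (le_zero_iff.1 h2)
  -- shadowing accuracy `η` for budgets within `δ/2`, closing constant `δ'` for `(ℓ, η)`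
  obtain ⟨η, hη, hshadow⟩ := h4b hK (half_pos hδ)
  obtain ⟨δ', hδ', hret⟩ := hclose ℓ η hη
  -- a recurrent point of `B ∩ Λ ℓ` with converging time means
  have hrec := h4a hK hμ (hB.inter (hΛm ℓ)) hδ'
  obtain ⟨x, ⟨hxB, hxΛ⟩, hxlim, hxfreq⟩ : ∃ x ∈ B ∩ Λ ℓ,
      (Tendsto (energyAvg φ x) atTop (𝓝 (En x)) ∧ Tendsto (dissipAvg ν φ x) atTop (𝓝 (D x))) ∧
      ∃ᶠ n : ℕ in atTop, φ n x ∈ B ∩ Λ ℓ ∧ dist (φ n x) x < δ' := by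
    obtain ⟨x, hx, h⟩ := Measure.exists_mem_of_measure_ne_zero_of_ae hℓ (ae_restrict_of_ae (hlim.and hrec))
    exact ⟨x, hx, h.1, h.2 hx⟩
  -- late return times have time means within `δ/2` of their limits
  have hnat₁ := hxlim.1.comp tendsto_natCast_atTop_atTop
  have hnat₂ := hxlim.2.comp tendsto_natCast_atTop_atTop
  have hev : ∀ᶠ n : ℕ in atTop, dist (energyAvg φ x n) (En x) < δ / 2 ∧
      dist (dissipAvg ν φ x n) (D x) < δ / 2 ∧ 0 < n :=
    ((Metric.tendsto_nhds.1 hnat₁ _ (half_pos hδ)).and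
      ((Metric.tendsto_nhds.1 hnat₂ _ (half_pos hδ)).and (eventually_gt_atTop 0)))
  obtain ⟨n, ⟨hn₁, hn₂, hn0⟩, ⟨-, hnΛ⟩, hndist⟩ := (hev.and_frequently hxfreq).exists
  -- close the return and transfer the budgets
  obtain ⟨z, hzK, T, hT, hTn, hfix, hsh⟩ := hret x hxΛ n hn0 hnΛ hndist
  obtain ⟨hE, hD⟩ := hshadow x (hΛK ℓ hxΛ) z hzK n hn0 T hTn hsh
  obtain ⟨hxE, hxD⟩ := hbud x hxB
  rw [Real.dist_eq] at hn₁ hn₂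
  refine ⟨z, hzK, T, hT, hfix, ?_, ?_⟩
  · have := abs_le.1 hE; have := abs_lt.1 hn₁; linarith [this]
  · have := abs_le.1 hD; have := abs_lt.1 hn₂; linarith [this]

/-- **The chain (1)–(2) at ONE force** (conditional on Stubs 2, 3a, 3b, 4a, 4b, 5): a loud hyperbolic invariant
measure of NS_ν(f_c) with `‖f_c‖₂ ≤ F` yields a loud classical periodic witness of the SAME force at the SAME `ν`,
with the `j`-uniformly inflated budgets `(16F²E²/ε² + ε/4, ε/4)`. [folklore] -/
theorem loudAt_of_hypLoud_of
    (h2 : (∀ {S : Finset (Fin 3 → ℤ)} {c : ↥S → (EuclideanSpace ℂ (Fin 3))} {ν : ℝ} {K : Set Hsp} {φ : ℝ → Hsp → Hsp} {μ : Measure Hsp},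
      0 < ν → IsNSPhase ν (force S c) K φ → IsInvariantMeasure K φ μ → IsHyperbolicMeasure ν (force S c) φ μ →
      ∃ (K' : Set Hsp) (φ' : ℝ → Hsp → Hsp), K ⊆ K' ∧ (∀ t : ℝ, 0 ≤ t → ∀ x ∈ K, φ' t x = φ t x) ∧
        IsNSPhase ν (force S c) K' φ' ∧ HasKatokClosing K' φ' μ))
    (h3a : (∀ {ν : ℝ} {F : (UnitAddTorus (Fin 3)) → (EuclideanSpace ℝ (Fin 3))} {K : Set Hsp} {φ : ℝ → Hsp → Hsp} {μ : Measure Hsp},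
      IsNSPhase ν F K φ → IsInvariantMeasure K φ μ →
      ∃ En D : Hsp → ℝ, Measurable En ∧ Measurable D ∧ (∀ x, 0 ≤ En x) ∧
        Integrable En μ ∧ Integrable D μ ∧ ∫ x, En x ∂μ = ensembleEnergy μ ∧
        ∫ x, D x ∂μ = ensembleDissipation ν μ ∧
        ∀ᵐ x ∂μ, Tendsto (energyAvg φ x) atTop (𝓝 (En x)) ∧ Tendsto (dissipAvg ν φ x) atTop (𝓝 (D x))))
    (h3b : (∀ {ν : ℝ} {F : (UnitAddTorus (Fin 3)) → (EuclideanSpace ℝ (Fin 3))} {K : Set Hsp} {φ : ℝ → Hsp → Hsp},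
      IsNSPhase ν F K φ → ∀ {x : Hsp}, x ∈ K → ∀ {e δ : ℝ},
      Tendsto (energyAvg φ x) atTop (𝓝 e) → Tendsto (dissipAvg ν φ x) atTop (𝓝 δ) →
      δ ≤ Real.sqrt (∫ y, ‖F y‖ ^ 2) * Real.sqrt e))
    (h4a : (∀ {ν : ℝ} {F : (UnitAddTorus (Fin 3)) → (EuclideanSpace ℝ (Fin 3))} {K : Set Hsp} {φ : ℝ → Hsp → Hsp} {μ : Measure Hsp},
      IsNSPhase ν F K φ → IsInvariantMeasure K φ μ → ∀ {A : Set Hsp}, MeasurableSet A → ∀ {r : ℝ}, 0 < r →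
      ∀ᵐ x ∂μ, x ∈ A → ∃ᶠ n : ℕ in atTop, φ n x ∈ A ∧ dist (φ n x) x < r))
    (h4b : (∀ {ν : ℝ} {F : (UnitAddTorus (Fin 3)) → (EuclideanSpace ℝ (Fin 3))} {K : Set Hsp} {φ : ℝ → Hsp → Hsp},
      IsNSPhase ν F K φ → ∀ {δ : ℝ}, 0 < δ →
      ∃ η : ℝ, 0 < η ∧ ∀ x ∈ K, ∀ z ∈ K, ∀ n : ℕ, 0 < n → ∀ T : ℝ, |T - n| ≤ η →
        (∀ k : ℕ, k ≤ n → dist (φ k z) (φ k x) ≤ η) →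
          |energyAvg φ z T - energyAvg φ x n| ≤ δ ∧ |dissipAvg ν φ z T - dissipAvg ν φ x n| ≤ δ))
    (h5 : (∀ {S : Finset (Fin 3 → ℤ)} {c : ↥S → (EuclideanSpace ℂ (Fin 3))} {ν : ℝ} {K : Set Hsp} {φ : ℝ → Hsp → Hsp} {z : Hsp} {T : ℝ},
      0 < ν → IsNSPhase ν (force S c) K φ → z ∈ K → 0 < T → φ T z = z →
      ∃ (u : ℝ → (UnitAddTorus (Fin 3)) → (EuclideanSpace ℝ (Fin 3))) (p : ℝ → (UnitAddTorus (Fin 3)) → ℝ),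
        IsClassicalNSSolutionOn univ ν (fun _ => force S c) u p ∧ Function.Periodic u T ∧
          meanEnergy u = energyAvg φ z T ∧ meanDissipation ν u = dissipAvg ν φ z T))
    {S : Finset (Fin 3 → ℤ)} {c : ↥S → (EuclideanSpace ℂ (Fin 3))} {ν : ℝ} {K : Set Hsp} {φ : ℝ → Hsp → Hsp}
    {μ : Measure Hsp} {E ε F : ℝ} (hν : 0 < ν) (hK : IsNSPhase ν (force S c) K φ)
    (hμ : IsInvariantMeasure K φ μ) (hH : IsHyperbolicMeasure ν (force S c) φ μ)
    (hF : Real.sqrt (∫ y, ‖force S c y‖ ^ 2) ≤ F) (hFpos : 0 < F) (hE : 0 < E) (hε : 0 < ε)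
    (hEn : ensembleEnergy μ ≤ E) (hD : ε ≤ ensembleDissipation ν μ) :
    LoudAt S ν (16 * F ^ 2 * E ^ 2 / ε ^ 2 + ε / 4) (ε / 4) c := by
  haveI := hμ.prob
  obtain ⟨K', φ', hKK', hagree, hK', hcl⟩ := h2 hν hK hμ hH
  have hμ' : IsInvariantMeasure K' φ' μ := hμ.enlarge hKK' hagree
  obtain ⟨En, D, hEm, hDm, hE0, hEi, hDi, hIE, hID, hpow, hlim⟩ := birkhoffPowerBudget_of h3a h3b hK' hμ'
  set B : Set Hsp := {x | En x ≤ 16 * F ^ 2 * E ^ 2 / ε ^ 2 ∧ ε / 2 ≤ D x} with hBdef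
  have hBm : MeasurableSet B := (hEm measurableSet_Iic).inter (hDm measurableSet_Ici)
  have hpow' : ∀ x, D x ≤ F * Real.sqrt (En x) := fun x =>
    (hpow x).trans (mul_le_mul_of_nonneg_right hF (Real.sqrt_nonneg _))
  have hsel := budget_selection μ hDm hEm hE0 hFpos hE hε hpow' hDi hEi (by rw [hID]; exact hD)
    (by rw [hIE]; exact hEn)
  have hμB : μ B ≠ 0 := by
    have hpos : 0 < ENNReal.ofReal (ε ^ 2 / (16 * F ^ 2 * E)) := ENNReal.ofReal_pos.2 (by positivity)
    exact (lt_of_lt_of_le hpos hsel).ne'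
  have hbud : ∀ x ∈ B, En x ≤ 16 * F ^ 2 * E ^ 2 / ε ^ 2 ∧ ε / 2 ≤ D x := fun x hx => hx
  obtain ⟨z, hz, T, hT, hfix, hEz, hDz⟩ :=
    closingWithBudgets_of h4a h4b hK' hμ' hcl hBm hμB hbud hlim (by positivity : (0:ℝ) < ε / 4)
  obtain ⟨u, p, hsol, hper, hmE, hmD⟩ := h5 hν hK' hz hT hfix
  refine ⟨T, u, p, hT, hsol, hper, ?_, ?_⟩
  · rw [hmE]; exact hEz
  · rw [hmD]; linarith

/-- Density survives intersection with an open set: `U' ∩ closure A ⊆ closure (U' ∩ A)`. [folklore] -/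
theorem subset_closure_inter_of_isOpen {X : Type*} [TopologicalSpace X] {U' A : Set X} (hU' : IsOpen U') :
    U' ∩ closure A ⊆ closure (U' ∩ A) :=
  hU'.inter_closure

/-- **LINE GLUE — the seven registered stubs prove the crux `DenseLoudDesignerForces` (by name).**
Given `S₀`, Stub 1 gives `S ⊇ S₀`, `E`, `ε > 0` and a window `U` for the loud-hyperbolic-measure sets `HYP_j`.
Shrink to `U' := U ∩ B(c₀, 1)` (still open, non-empty, `HYP_j` still dense in it), on which
`‖f_c‖₂ ≤ F := √(#S)(‖c₀‖+1) + 1` (`sqrt_forceEnergy_le`); put `E₊ := max E 1`.  The crux's witnesses are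
`(S, E* := 16F²E₊²/ε² + ε/4, ε* := ε/4, U')`: for every `j`, `HYP_j ∩ U' ⊆ LOUD_j(S,E*,ε*)` by
`loudAt_of_hypLoud_of`, and `U' ⊆ closure (HYP_j ∩ U') ⊆ closure LOUD_j`. [folklore] -/
theorem ergodic_line_glue
    (h1 : (∀ S₀ : Finset (Fin 3 → ℤ), ∃ S : Finset (Fin 3 → ℤ), S₀ ⊆ S ∧ ∃ (E ε : ℝ), 0 < ε ∧
      ∃ U : Set (↥S → (EuclideanSpace ℂ (Fin 3))), IsOpen U ∧ U.Nonempty ∧ ∀ j : ℕ, U ⊆ closure (hypLoudSet S E ε j)))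
    (h2 : (∀ {S : Finset (Fin 3 → ℤ)} {c : ↥S → (EuclideanSpace ℂ (Fin 3))} {ν : ℝ} {K : Set Hsp} {φ : ℝ → Hsp → Hsp} {μ : Measure Hsp},
      0 < ν → IsNSPhase ν (force S c) K φ → IsInvariantMeasure K φ μ → IsHyperbolicMeasure ν (force S c) φ μ →
      ∃ (K' : Set Hsp) (φ' : ℝ → Hsp → Hsp), K ⊆ K' ∧ (∀ t : ℝ, 0 ≤ t → ∀ x ∈ K, φ' t x = φ t x) ∧
        IsNSPhase ν (force S c) K' φ' ∧ HasKatokClosing K' φ' μ))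
    (h3a : (∀ {ν : ℝ} {F : (UnitAddTorus (Fin 3)) → (EuclideanSpace ℝ (Fin 3))} {K : Set Hsp} {φ : ℝ → Hsp → Hsp} {μ : Measure Hsp},
      IsNSPhase ν F K φ → IsInvariantMeasure K φ μ →
      ∃ En D : Hsp → ℝ, Measurable En ∧ Measurable D ∧ (∀ x, 0 ≤ En x) ∧
        Integrable En μ ∧ Integrable D μ ∧ ∫ x, En x ∂μ = ensembleEnergy μ ∧
        ∫ x, D x ∂μ = ensembleDissipation ν μ ∧
        ∀ᵐ x ∂μ, Tendsto (energyAvg φ x) atTop (𝓝 (En x)) ∧ Tendsto (dissipAvg ν φ x) atTop (𝓝 (D x))))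
    (h3b : (∀ {ν : ℝ} {F : (UnitAddTorus (Fin 3)) → (EuclideanSpace ℝ (Fin 3))} {K : Set Hsp} {φ : ℝ → Hsp → Hsp},
      IsNSPhase ν F K φ → ∀ {x : Hsp}, x ∈ K → ∀ {e δ : ℝ},
      Tendsto (energyAvg φ x) atTop (𝓝 e) → Tendsto (dissipAvg ν φ x) atTop (𝓝 δ) →
      δ ≤ Real.sqrt (∫ y, ‖F y‖ ^ 2) * Real.sqrt e))
    (h4a : (∀ {ν : ℝ} {F : (UnitAddTorus (Fin 3)) → (EuclideanSpace ℝ (Fin 3))} {K : Set Hsp} {φ : ℝ → Hsp → Hsp} {μ : Measure Hsp},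
      IsNSPhase ν F K φ → IsInvariantMeasure K φ μ → ∀ {A : Set Hsp}, MeasurableSet A → ∀ {r : ℝ}, 0 < r →
      ∀ᵐ x ∂μ, x ∈ A → ∃ᶠ n : ℕ in atTop, φ n x ∈ A ∧ dist (φ n x) x < r))
    (h4b : (∀ {ν : ℝ} {F : (UnitAddTorus (Fin 3)) → (EuclideanSpace ℝ (Fin 3))} {K : Set Hsp} {φ : ℝ → Hsp → Hsp},
      IsNSPhase ν F K φ → ∀ {δ : ℝ}, 0 < δ →
      ∃ η : ℝ, 0 < η ∧ ∀ x ∈ K, ∀ z ∈ K, ∀ n : ℕ, 0 < n → ∀ T : ℝ, |T - n| ≤ η →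
        (∀ k : ℕ, k ≤ n → dist (φ k z) (φ k x) ≤ η) →
          |energyAvg φ z T - energyAvg φ x n| ≤ δ ∧ |dissipAvg ν φ z T - dissipAvg ν φ x n| ≤ δ))
    (h5 : (∀ {S : Finset (Fin 3 → ℤ)} {c : ↥S → (EuclideanSpace ℂ (Fin 3))} {ν : ℝ} {K : Set Hsp} {φ : ℝ → Hsp → Hsp} {z : Hsp} {T : ℝ},
      0 < ν → IsNSPhase ν (force S c) K φ → z ∈ K → 0 < T → φ T z = z →
      ∃ (u : ℝ → (UnitAddTorus (Fin 3)) → (EuclideanSpace ℝ (Fin 3))) (p : ℝ → (UnitAddTorus (Fin 3)) → ℝ),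
        IsClassicalNSSolutionOn univ ν (fun _ => force S c) u p ∧ Function.Periodic u T ∧
          meanEnergy u = energyAvg φ z T ∧ meanDissipation ν u = dissipAvg ν φ z T)) :
    DenseLoudDesignerForces := by
  intro S₀
  obtain ⟨S, hS, E, ε, hε, U, hUo, ⟨c₀, hc₀⟩, hdense⟩ := h1 S₀
  have hU'o : IsOpen (U ∩ Metric.ball c₀ 1) := hUo.inter Metric.isOpen_ball
  have hEpos : 0 < max E 1 := lt_of_lt_of_le one_pos (le_max_right _ _)
  have hFpos : 0 < Real.sqrt (S.card * (‖c₀‖ + 1) ^ 2) + 1 := by positivity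
  refine ⟨S, hS,
    16 * (Real.sqrt (S.card * (‖c₀‖ + 1) ^ 2) + 1) ^ 2 * (max E 1) ^ 2 / ε ^ 2 + ε / 4, ε / 4,
    by positivity, U ∩ Metric.ball c₀ 1, hU'o, ⟨c₀, hc₀, Metric.mem_ball_self one_pos⟩, fun j => ?_⟩
  rintro c ⟨hcU, hcball⟩
  have h1' : c ∈ closure ((U ∩ Metric.ball c₀ 1) ∩ hypLoudSet S E ε j) :=
    subset_closure_inter_of_isOpen hU'o ⟨⟨hcU, hcball⟩, hdense j hcU⟩
  refine closure_mono ?_ h1'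
  rintro c' ⟨⟨-, hc'ball⟩, ν, hν, hνj, K, φ, μ, hK, hμ, hEn, hD, hH⟩
  have hF : Real.sqrt (∫ y, ‖force S c' y‖ ^ 2) ≤ Real.sqrt (S.card * (‖c₀‖ + 1) ^ 2) + 1 := by
    have hdist : dist c' c₀ < 1 := by rwa [Metric.mem_ball] at hc'ball
    have := sqrt_forceEnergy_le hdist
    linarith
  exact ⟨ν, hν, hνj, loudAt_of_hypLoud_of h2 h3a h3b h4a h4b h5 hν hK hμ hH hF hFpos hEpos hε
    (hEn.trans (le_max_left _ _)) hD⟩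

end Summit.AnomalousDissipation.AnomalousDissipation.Theorems.DenseLoudDesignerForces.Ergodic

end
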